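import Summits.ABC.ABC.Theses.TwistAmplification
import Literature.NumberTheory.EllipticCurves.SzpiroOfAbcProofs
import Literature.NumberTheory.EllipticCurves.SzpiroLocalDataProofs
import Literature.NumberTheory.DiophantineGeometry.LocalReductionProofs
import HarnessLib

/-!
# Route TwistAmplification — crux `SomeWindowSaving` (stmt-ABC-1976), line `polynomial-degree-suffices`:
# stub T3, the twist transfer of weak generalized Szpiro (assembly of T1 and T2)

`stub_twistTransferSzpiro : TwistConductorDvd → TwistSizeTransfer → TwistTransferSzpiro` (the three
`Prop`s of the line skeleton, expanded over existing declarations).  WEAK GENERALIZED SZPIRO for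
SEMISTABLE minimal integral models — `max(|Δ(W₀)|, |c₄(W₀)|³) ≤ C · N^K` for every `W₀/ℤ` minimal at every
place with `W₀ ⊗ ℚ` elliptic and semistable (exponent `K ≥ 0`, constant `C`) — transfers to every minimal
`W₀/ℤ` in the TWIST CLASS (some `d ≡ 1 (mod 4)` with `d² ∣ N(W₀ ⊗ ℚ)` and `(W₀ ⊗ ℚ)^{(d)}` semistable) at the
cost `K ↦ K + 3`, GIVEN the two sibling stubs as hypotheses:

* T1 (`TwistConductorDvd`): `N((W₀ ⊗ ℚ)^{(d)}) ∣ N(W₀ ⊗ ℚ)` for such `d`;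
* T2 (`TwistSizeTransfer`): `|Δ(W₀)| ≤ |d|⁶ |Δ(W')|`, `|c₄(W₀)| ≤ |d|² |c₄(W')|` for ANY integral model
  `W'/ℤ` of the twist (`C • (W₀ ⊗ ℚ)^{(d)} = W' ⊗ ℚ`).

Proof (elementary bookkeeping over proved tree theorems): take a global minimal model `W'/ℤ` of the twist
`E' := (W₀ ⊗ ℚ).quadraticTwist d` (`WeierstrassCurve.exists_baseChange_int_forall_isMinimalAt`; `E'` is
elliptic as `d ≠ 0`, `WeierstrassCurve.isElliptic_quadraticTwist`); `W' ⊗ ℚ = C' • E'` is elliptic and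
semistable (`WeierstrassCurve.isSemistable_smul_iff_holds`) with conductor `N' = N(E')`
(`WeierstrassCurve.conductorNorm_smul_rat`) `≤ N := N(W₀ ⊗ ℚ)` (T1 and `conductorNorm_pos_holds`); the
hypothesis gives `max(|Δ(W')|, |c₄(W')|³) ≤ C · N'^K ≤ C · N^K` (this also forces `C ≥ 0`), T2 gives
`max(|Δ(W₀)|, |c₄(W₀)|³) ≤ |d|⁶ · max(|Δ(W')|, |c₄(W')|³)`, and `d² ∣ N` gives `|d|⁶ ≤ N³`.

Deliberately NOT here: T1, T2 themselves (sibling stubs), anything about the residue class or the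
polynomial modular-degree bound.  Lands `--supports stmt-ABC-1976`.
-/

noncomputable section

open IsDedekindDomain WeierstrassCurve

-- `Summit.<Summit>.<Problem>` is the mandated summit-side namespace (CONVENTIONS §2); for the
-- single-conjunct summit `ABC` the two coincide, so the duplicate `ABC.ABC` is deliberate.
set_option linter.dupNamespace false

namespace Summit.ABC.ABC.Theorems

namespace TwistTransferSzpiro

/-- An integer `d ≡ 1 (mod 4)` is non-zero. [folklore] -/
theorem ne_zero_of_modEq_one_four {d : ℤ} (hd : d ≡ 1 [ZMOD 4]) : d ≠ 0 := by
  rintro rfl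
  revert hd
  decide

/-- Size bookkeeping in `ℤ`: from `|Δ₀| ≤ |d|⁶ |Δ'|` and `|c₀| ≤ |d|² |c'|`,
`max |Δ₀| (|c₀|³) ≤ |d|⁶ · max |Δ'| (|c'|³)`. [folklore] -/
theorem max_le_pow_six_mul_max {d Δ₀ Δ' c₀ c' : ℤ} (hΔ : |Δ₀| ≤ |d| ^ 6 * |Δ'|)
    (hc : |c₀| ≤ |d| ^ 2 * |c'|) :
    max |Δ₀| (|c₀| ^ 3) ≤ |d| ^ 6 * max |Δ'| (|c'| ^ 3) := by
  have hd6 : (0 : ℤ) ≤ |d| ^ 6 := pow_nonneg (abs_nonneg d) 6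
  refine max_le ?_ ?_
  · exact le_trans hΔ (mul_le_mul_of_nonneg_left (le_max_left _ _) hd6)
  · calc |c₀| ^ 3 ≤ (|d| ^ 2 * |c'|) ^ 3 := pow_le_pow_left₀ (abs_nonneg _) hc 3
      _ = |d| ^ 6 * |c'| ^ 3 := by ring
      _ ≤ |d| ^ 6 * max |Δ'| (|c'| ^ 3) := mul_le_mul_of_nonneg_left (le_max_right _ _) hd6

/-- Size bookkeeping in `ℕ`/`ℝ`: if `d.natAbs ^ 2 ∣ N` with `0 < N` then `|d|⁶ ≤ N³` (as reals). [folklore] -/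
theorem abs_pow_six_le_of_natAbs_sq_dvd {d : ℤ} {N : ℕ} (hN : 0 < N) (hdN : d.natAbs ^ 2 ∣ N) :
    (|(d : ℝ)|) ^ 6 ≤ (N : ℝ) ^ 3 := by
  have h1 : d.natAbs ^ 2 ≤ N := Nat.le_of_dvd hN hdN
  have h2 : d.natAbs ^ 6 ≤ N ^ 3 := by
    calc d.natAbs ^ 6 = (d.natAbs ^ 2) ^ 3 := by ring
      _ ≤ N ^ 3 := Nat.pow_le_pow_left h1 3
  have h3 : ((d.natAbs ^ 6 : ℕ) : ℝ) ≤ ((N ^ 3 : ℕ) : ℝ) := Nat.cast_le.mpr h2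
  simpa [Nat.cast_pow, Nat.cast_natAbs, Int.cast_abs] using h3

/-- The real-arithmetic core: from `M₀ ≤ D · M'`, `M' ≤ C · N'^K`, `0 ≤ M'`, `0 < N' ≤ N`, `D ≤ N³`,
`K ≥ 0`, conclude `M₀ ≤ C · N^(K+3)` (the hypotheses force `0 ≤ C`). [folklore] -/
theorem le_mul_rpow_add_three {M₀ M' D C N N' K : ℝ} (hK : 0 ≤ K) (hM₀ : M₀ ≤ D * M')
    (hM' : M' ≤ C * N' ^ K) (hM'0 : 0 ≤ M') (hN'0 : 0 < N') (hN'N : N' ≤ N)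
    (hD : D ≤ N ^ (3 : ℕ)) : M₀ ≤ C * N ^ (K + 3) := by
  have hN0 : 0 < N := lt_of_lt_of_le hN'0 hN'N
  have hNK0 : 0 < N' ^ K := Real.rpow_pos_of_pos hN'0 K
  have hC0 : 0 ≤ C := nonneg_of_mul_nonneg_left (le_trans hM'0 hM') hNK0
  have hKK : N' ^ K ≤ N ^ K := Real.rpow_le_rpow hN'0.le hN'N hK
  have hsplit : N ^ (K + 3) = N ^ K * N ^ (3 : ℕ) := by
    rw [show (K + 3 : ℝ) = K + ((3 : ℕ) : ℝ) by norm_num, Real.rpow_add_natCast hN0.ne']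
  calc M₀ ≤ D * M' := hM₀
    _ ≤ N ^ (3 : ℕ) * (C * N ^ K) :=
        mul_le_mul hD (le_trans hM' (mul_le_mul_of_nonneg_left hKK hC0)) hM'0
          (pow_nonneg hN0.le 3)
    _ = C * N ^ (K + 3) := by rw [hsplit]; ring

end TwistTransferSzpiro

open TwistTransferSzpiro in
/-- **Stub T3 of line `polynomial-degree-suffices` (crux `SomeWindowSaving`, stmt-ABC-1976):
`TwistConductorDvd → TwistSizeTransfer → TwistTransferSzpiro`.**  Weak generalized Szpiro for
semistable minimal integral models (exponent `K ≥ 0`, constant `C`) transfers to every minimal `W₀/ℤ`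
admitting `d ≡ 1 (mod 4)` with `d² ∣ N(W₀ ⊗ ℚ)` and semistable twist `(W₀ ⊗ ℚ)^{(d)}`, at the cost
`K ↦ K + 3`, given conductor divisibility (T1) and size transfer (T2) as hypotheses.  Proof: global
minimal model `W'` of the twist (`exists_baseChange_int_forall_isMinimalAt`), invariance of
semistability and conductor under `ℚ`-isomorphism (`isSemistable_smul_iff_holds`, `conductorNorm_smul_rat`),
`N(E^{(d)}) ≤ N` (T1), `max₀ ≤ |d|⁶ max'` (T2), `|d|⁶ ≤ N³`. [folklore] -/
theorem stub_twistTransferSzpiro :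
    (∀ (W₀ : WeierstrassCurve ℤ), (W₀.baseChange ℚ).IsElliptic →
      ∀ d : ℤ, d ≡ 1 [ZMOD 4] → d.natAbs ^ 2 ∣ (W₀.baseChange ℚ).conductorNorm ℤ →
        ((W₀.baseChange ℚ).quadraticTwist (d : ℚ)).IsSemistable ℤ →
          ((W₀.baseChange ℚ).quadraticTwist (d : ℚ)).conductorNorm ℤ ∣
            (W₀.baseChange ℚ).conductorNorm ℤ) →
    (∀ (W₀ W' : WeierstrassCurve ℤ), (W₀.baseChange ℚ).IsElliptic →
      (∀ v : HeightOneSpectrum ℤ, (W₀.baseChange ℚ).IsMinimalAt v) →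
        ∀ (d : ℤ) (C : WeierstrassCurve.VariableChange ℚ), d ≡ 1 [ZMOD 4] →
          C • (W₀.baseChange ℚ).quadraticTwist (d : ℚ) = W'.baseChange ℚ →
            |W₀.Δ| ≤ |d| ^ 6 * |W'.Δ| ∧ |W₀.c₄| ≤ |d| ^ 2 * |W'.c₄|) →
    ∀ K C : ℝ, 0 ≤ K →
      (∀ W₀ : WeierstrassCurve ℤ, (W₀.baseChange ℚ).IsElliptic →
        (∀ v : HeightOneSpectrum ℤ, (W₀.baseChange ℚ).IsMinimalAt v) →
          (W₀.baseChange ℚ).IsSemistable ℤ →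
            ((max |W₀.Δ| (|W₀.c₄| ^ 3) : ℤ) : ℝ) ≤
              C * (((W₀.baseChange ℚ).conductorNorm ℤ : ℕ) : ℝ) ^ K) →
      ∀ W₀ : WeierstrassCurve ℤ, (W₀.baseChange ℚ).IsElliptic →
        (∀ v : HeightOneSpectrum ℤ, (W₀.baseChange ℚ).IsMinimalAt v) →
          ∀ d : ℤ, d ≡ 1 [ZMOD 4] → d.natAbs ^ 2 ∣ (W₀.baseChange ℚ).conductorNorm ℤ →
            ((W₀.baseChange ℚ).quadraticTwist (d : ℚ)).IsSemistable ℤ →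
              ((max |W₀.Δ| (|W₀.c₄| ^ 3) : ℤ) : ℝ) ≤
                C * (((W₀.baseChange ℚ).conductorNorm ℤ : ℕ) : ℝ) ^ (K + 3) := by
  intro hT1 hT2 K C hK hss W₀ hE hmin d hd4 hdN hdss
  -- the twist `E'` of `E := W₀ ⊗ ℚ` is elliptic (`d ≠ 0`)
  have hd0 : (d : ℚ) ≠ 0 := by exact_mod_cast ne_zero_of_modEq_one_four hd4
  haveI hE' : ((W₀.baseChange ℚ).quadraticTwist (d : ℚ)).IsElliptic :=
    (W₀.baseChange ℚ).isElliptic_quadraticTwist hd0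
  -- a global minimal model `W'/ℤ` of the twist
  obtain ⟨C', W', hC', hmin'⟩ :=
    exists_baseChange_int_forall_isMinimalAt ((W₀.baseChange ℚ).quadraticTwist (d : ℚ))
  haveI hEW' : (W'.baseChange ℚ).IsElliptic := by
    rw [← hC']
    infer_instance
  have hssW' : (W'.baseChange ℚ).IsSemistable ℤ := by
    rw [← hC']
    exact (isSemistable_smul_iff_holds ℤ ((W₀.baseChange ℚ).quadraticTwist (d : ℚ)) C').mpr hdss
  have hNW' : (W'.baseChange ℚ).conductorNorm ℤ =
      ((W₀.baseChange ℚ).quadraticTwist (d : ℚ)).conductorNorm ℤ := by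
    rw [← hC']
    exact conductorNorm_smul_rat _ C'
  -- weak generalized Szpiro for the semistable minimal model `W'`
  have hM' := hss W' hEW' hmin' hssW'
  -- conductors: `0 < N' = N(E') ≤ N`
  have hNpos : 0 < (W₀.baseChange ℚ).conductorNorm ℤ := conductorNorm_pos_holds (W₀.baseChange ℚ)
  have hN'pos : 0 < (W'.baseChange ℚ).conductorNorm ℤ := conductorNorm_pos_holds (W'.baseChange ℚ)
  have hN'le : (W'.baseChange ℚ).conductorNorm ℤ ≤ (W₀.baseChange ℚ).conductorNorm ℤ := by
    rw [hNW']
    exact Nat.le_of_dvd hNpos (hT1 W₀ hE d hd4 hdN hdss)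
  -- sizes: `max₀ ≤ |d|⁶ · max'` (T2) and `0 < max'`
  obtain ⟨hΔle, hc₄le⟩ := hT2 W₀ W' hE hmin d C' hd4 hC'
  have hmax : max |W₀.Δ| (|W₀.c₄| ^ 3) ≤ |d| ^ 6 * max |W'.Δ| (|W'.c₄| ^ 3) :=
    max_le_pow_six_mul_max hΔle hc₄le
  have hmax'0 : (0 : ℤ) ≤ max |W'.Δ| (|W'.c₄| ^ 3) := le_trans (abs_nonneg _) (le_max_left _ _)
  -- assemble in `ℝ`
  refine le_mul_rpow_add_three (D := (|(d : ℝ)|) ^ 6) (M' := ((max |W'.Δ| (|W'.c₄| ^ 3) : ℤ) : ℝ))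
    (N' := (((W'.baseChange ℚ).conductorNorm ℤ : ℕ) : ℝ)) hK ?_ hM' (by exact_mod_cast hmax'0)
    (by exact_mod_cast hN'pos) (by exact_mod_cast hN'le) (abs_pow_six_le_of_natAbs_sq_dvd hNpos hdN)
  exact_mod_cast hmax

end Summit.ABC.ABC.Theorems
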